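import Literature.NumberTheory.DiophantineApproximation.RhinViolaDoubleResidue
import Literature.NumberTheory.DiophantineApproximation.RhinViolaBetaLogIntegrals
import Literature.NumberTheory.DiophantineApproximation.DilogHermitePadeArithmetic
import Mathlib.Data.Nat.Choose.Sum
import HarnessLib

/-!
# Rhin–Viola 2005, Lemma 2.7: Theorem 2.1 for the tuples `(h, j, 0, 0, j)`

Topic `Literature/NumberTheory/DiophantineApproximation`. DEFINITIONS (the coefficient `coeff27`, the index set
`indexSet27`, and the explicit polynomials `lemma27P`, `lemma27Q`, `lemma27R`) and proved theorems; no named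
facts. Source: G. Rhin, C. Viola, *The permutation group method for the dilogarithm*, Ann. Sc. Norm. Super.
Pisa Cl. Sci. (5) 4 (2005) 389–437, Lemma 2.7 (pp. 402–404): if `k = l = 0` and `m = j` then Theorem 2.1 holds,
i.e. (here `H = K = δ = h+j`, `α = j`, `β = 0`)

  `d_{h+j}² z^j I_z(h,j,0,0,j) = P(z) − Q(z) Li₂(1/z)`,  `d_{h+j}² z^j I_z^{(1)}(h,j,0,0,j) = R(z) − Q(z) Li₁(1/z)`,
  `d_{h+j}² z^j I_z^{(2)}(h,j,0,0,j) = Q(z) = (−1)^{h+1} d_{h+j}² z^j (z−1)^h`,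

with `P, Q, R ∈ ℤ[z]` of degree `≤ h + j`. The proof follows the paper: `z^j I^{(1)} = ∫₀¹ x^j(1−x)^h dx/(z−x)`
(2.25), `z^j I = −∫₀¹ x^j(1−x)^h log x dx/(z−x)` (2.26) (from (2.12), Fubini), the expansion
`x = z − (z−x)`, `1 − x = (z−x) − (z−1)` (2.27), and the elementary integrals of
`RhinViolaBetaLogIntegrals.lean` / `RhinViolaBaseIntegrals.lean`; `z^j I^{(2)} = −z^j(1−z)^h` is read off
the residue form of `I2`.

## References

* G. Rhin, C. Viola, Ann. Sc. Norm. Super. Pisa Cl. Sci. (5) 4 (2005) 389–437, Lemma 2.7, (2.25)–(2.28).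
  [RhinViola2005]
-/

noncomputable section

namespace Literature.NumberTheory.DiophantineApproximation

namespace RhinViola

open _root_.MeasureTheory _root_.Set intervalIntegral Finset Polynomial
open DilogPade (polylogSeries)
open ViolaZudilin (unitSquare weight denom₁ measurableSet_unitSquare)

/-! ### The three integrals at `(h, j, 0, 0, j)` -/

/-- At `(h,j,0,0,j)` the inner residue is `1/(z−x)` (RV (2.10)). [cite: RhinViola2005, (2.10) and (2.25)] -/
theorem innerRes_h_j (z x : ℝ) (j : ℕ) : innerRes z j 0 0 j x = 1 / (z - x) := by
  rw [innerRes, if_pos (by omega)]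
  simp

/-- **RV (2.25)**: `I_z^{(1)}(h,j,0,0,j) = z^{−j} ∫₀¹ x^j(1−x)^h dx/(z−x)`. [cite: RhinViola2005, (2.25)] -/
theorem I1_h_j (z : ℝ) (h j : ℕ) :
    I1 z h j 0 0 j = z ^ (-(j : ℤ)) * ∫ x in (0 : ℝ)..1, x ^ j * (1 - x) ^ h / (z - x) := by
  rw [I1]
  simp only [innerRes_h_j, Nat.cast_zero, zero_add, mul_one_div]

/-- `I_z^{(2)}(h,j,0,0,j) = −(1−z)^h`, i.e. `z^j I^{(2)} = −Res_{x=z} x^j(1−x)^h/(x−z) = −z^j(1−z)^h` (RV p. 404).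
[cite: RhinViola2005, Lemma 2.7 (proof), p. 404] -/
theorem I2_h_j {z : ℝ} (hz : z ≠ 0) (h j : ℕ) : I2 z h j 0 0 j = -(1 - z) ^ h := by
  rw [I2, if_pos (by omega)]
  simp only [Nat.add_zero, Nat.sub_self, pow_zero, mul_one, hasseDeriv_zero', one_comp, zero_add,
    sum_range_one, coeff_one_zero, one_mul, Nat.cast_zero, eval_mul, eval_pow, eval_X, eval_sub, eval_one,
    pow_one, zpow_neg, zpow_natCast]
  field_simp

/-- At `(h,j,0,0,j)` the real integrand is `x^j(1−x)^h/(x(1−y)+yz)` (everywhere, with the tree's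
conventions at `D = 0`). [cite: RhinViola2005, (2.1)] -/
theorem integrand_h_j (z : ℝ) (h j : ℕ) (p : ℝ × ℝ) :
    integrand z h j 0 0 j p = p.1 ^ j * (1 - p.1) ^ h * weight z p := by
  unfold integrand weight
  by_cases hD : denom₁ z p = 0
  · simp [hD]
  · rw [pow_zero, pow_zero, mul_one, mul_one, Nat.add_zero, pow_succ]
    field_simp

/-- **RV (2.12) ⇒ the `x`-section**: for `0 < x ≤ 1 < z`,
`∫₀¹ integrand dy = x^j(1−x)^h (log z − log x)/(z−x)`. [cite: RhinViola2005, (2.12)] -/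
theorem integral_integrand_h_j_section {z x : ℝ} (hz : 1 < z) (hx : x ∈ Ioc (0 : ℝ) 1) (h j : ℕ) :
    ∫ y in Icc (0 : ℝ) 1, integrand z h j 0 0 j (x, y) =
      x ^ j * (1 - x) ^ h * ((Real.log z - Real.log x) / (z - x)) := by
  simp only [integrand_h_j]
  rw [integral_Icc_eq_integral_Ioc, ← integral_of_le zero_le_one, intervalIntegral.integral_const_mul]
  congr 1
  have hsec := integral_weight_section hx.1 (hx.2.trans_lt hz)
  simp only [weight, denom₁] at hsec ⊢
  exact hsec

/-- **RV (2.26), first half (Fubini)**: for `z > 1`,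
`z^j I_z^{(0)}(h,j,0,0,j) = (log z) ∫₀¹ x^j(1−x)^h dx/(z−x) + ∫₀¹ x^j(1−x)^h (−log x) dx/(z−x)`.
[cite: RhinViola2005, (2.26)] -/
theorem I0_h_j {z : ℝ} (hz : 1 < z) (h j : ℕ) :
    I0 z h j 0 0 j = z ^ (-(j : ℤ)) *
      ((Real.log z * ∫ x in (0 : ℝ)..1, x ^ j * (1 - x) ^ h / (z - x))
        + ∫ x in (0 : ℝ)..1, x ^ j * (1 - x) ^ h * (-Real.log x / (z - x))) := by
  -- Fubini on the square
  have hint : Integrable (integrand z h j 0 0 j)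
      (((volume : Measure ℝ).restrict (Icc 0 1)).prod ((volume : Measure ℝ).restrict (Icc 0 1))) := by
    have hi := integrableOn_integrand hz.le h j 0 0 j
    rwa [IntegrableOn, ViolaZudilin.volume_restrict_unitSquare] at hi
  have hF : ∫ p in unitSquare, integrand z h j 0 0 j p =
      ∫ x in Icc (0 : ℝ) 1, ∫ y in Icc (0 : ℝ) 1, integrand z h j 0 0 j (x, y) := by
    rw [show (∫ p in unitSquare, integrand z h j 0 0 j p) = ∫ p, integrand z h j 0 0 j p
        ∂((volume : Measure ℝ).restrict (Icc 0 1)).prod ((volume : Measure ℝ).restrict (Icc 0 1)) by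
      rw [← ViolaZudilin.volume_restrict_unitSquare]]
    exact integral_prod _ hint
  have hinner : EqOn (fun x : ℝ => ∫ y in Icc (0 : ℝ) 1, integrand z h j 0 0 j (x, y))
      (fun x => Real.log z * (x ^ j * (1 - x) ^ h / (z - x)) + x ^ j * (1 - x) ^ h * (-Real.log x / (z - x)))
      (Ioc (0 : ℝ) 1) := by
    intro x hx
    simp only
    rw [integral_integrand_h_j_section hz hx]
    ring
  -- integrability of the two pieces on `(0,1]`
  have hc1 : ContinuousOn (fun x : ℝ => x ^ j * (1 - x) ^ h / (z - x)) (Icc (0 : ℝ) 1) :=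
    (by fun_prop : Continuous fun x : ℝ => x ^ j * (1 - x) ^ h).continuousOn.div
      (continuousOn_const.sub continuousOn_id) fun x hx => by linarith [hx.2]
  have h1 : IntegrableOn (fun x : ℝ => Real.log z * (x ^ j * (1 - x) ^ h / (z - x))) (Ioc (0 : ℝ) 1) :=
    (hc1.integrableOn_Icc.mono_set Ioc_subset_Icc_self).const_mul _
  have h2 : IntegrableOn (fun x : ℝ => x ^ j * (1 - x) ^ h * (-Real.log x / (z - x))) (Ioc (0 : ℝ) 1) := by
    have hlog : IntegrableOn (fun x : ℝ => Real.log x) (Ioc (0 : ℝ) 1) :=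
      (intervalIntegrable_iff_integrableOn_Ioc_of_le zero_le_one).1 intervalIntegrable_log'
    refine (hlog.norm.const_mul (1 / (z - 1))).mono' ?_ ?_
    · exact ((by fun_prop : Continuous fun x : ℝ => x ^ j * (1 - x) ^ h).measurable.mul
        (Real.measurable_log.neg.div (measurable_const.sub measurable_id))).aestronglyMeasurable
    · filter_upwards [ae_restrict_mem measurableSet_Ioc] with x hx
      have hzx : 0 < z - x := by linarith [hx.2]
      have hx1 : 0 ≤ 1 - x := by linarith [hx.2]
      have hnum : |x ^ j * (1 - x) ^ h| ≤ 1 := by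
        rw [abs_mul, abs_pow, abs_pow, abs_of_nonneg hx.1.le, abs_of_nonneg hx1]
        exact mul_le_one₀ (pow_le_one₀ hx.1.le hx.2) (pow_nonneg hx1 _)
          (pow_le_one₀ hx1 (by linarith [hx.1]))
      rw [Real.norm_eq_abs, abs_mul, abs_div, abs_neg, abs_of_pos hzx, Real.norm_eq_abs]
      calc |x ^ j * (1 - x) ^ h| * (|Real.log x| / (z - x))
          ≤ 1 * (|Real.log x| / (z - x)) := by gcongr
        _ ≤ 1 * (|Real.log x| / (z - 1)) := by gcongr; linarith [hx.2]
        _ = 1 / (z - 1) * |Real.log x| := by ring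
  rw [I0, hF, integral_Icc_eq_integral_Ioc, setIntegral_congr_fun measurableSet_Ioc hinner,
    integral_add h1 h2, MeasureTheory.integral_const_mul, ← integral_of_le zero_le_one,
    ← integral_of_le zero_le_one]
  simp only [Nat.cast_zero, zero_add]

/-- **RV (2.26)**: `I_z(h,j,0,0,j) = z^{−j} ∫₀¹ x^j(1−x)^h (−log x) dx/(z−x)` for `z > 1`.
[cite: RhinViola2005, (2.26)] -/
theorem I_h_j {z : ℝ} (hz : 1 < z) (h j : ℕ) :
    I z h j 0 0 j = z ^ (-(j : ℤ)) * ∫ x in (0 : ℝ)..1, x ^ j * (1 - x) ^ h * (-Real.log x / (z - x)) := by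
  rw [I, I0_h_j hz, I1_h_j]
  ring

/-! ### The expansion `x = z − (z−x)`, `1 − x = (z−x) + (1−z)` (RV (2.27))

With `c_{rs} = C(j,r) C(h,s) (−1)^r z^{j−r} (1−z)^{h−s}` one has `x^j(1−x)^h = Σ_{r≤j,s≤h} c_{rs}(z−x)^{r+s}`;
the term `(r,s) = (0,0)` is `z^j(1−z)^h`, and the others carry a factor `z − x`. We index by
`p = (r,s) ∈ T := ([0,j] × [0,h]) ∖ {(0,0)}`. -/

/-- The coefficient `c_{rs} = C(j,r) C(h,s) (−1)^r z^{j−r} (1−z)^{h−s}` of `(z−x)^{r+s}` in `x^j(1−x)^h`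
(`p = (r, s)`). [cite: RhinViola2005, (2.27)] -/
def coeff27 (z : ℝ) (h j : ℕ) (p : ℕ × ℕ) : ℝ :=
  (j.choose p.1 : ℝ) * (h.choose p.2) * (-1) ^ p.1 * z ^ (j - p.1) * (1 - z) ^ (h - p.2)

/-- The index set `T = ([0,j] × [0,h]) ∖ {(0,0)}` of the terms carrying a factor `z − x`.
[cite: RhinViola2005, (2.27)] -/
def indexSet27 (h j : ℕ) : Finset (ℕ × ℕ) := (range (j + 1) ×ˢ range (h + 1)).erase (0, 0)

/-- `x^j (1−x)^h = Σ_{r≤j, s≤h} c_{rs} (z−x)^{r+s}`. [cite: RhinViola2005, (2.27)] -/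
theorem pow_mul_one_sub_pow_eq_sum (z x : ℝ) (h j : ℕ) :
    x ^ j * (1 - x) ^ h = ∑ p ∈ range (j + 1) ×ˢ range (h + 1),
      coeff27 z h j p * (z - x) ^ (p.1 + p.2) := by
  have hx : x ^ j = ∑ r ∈ range (j + 1), (-(z - x)) ^ r * z ^ (j - r) * (j.choose r : ℝ) := by
    rw [← add_pow]; ring
  have h1x : (1 - x) ^ h = ∑ s ∈ range (h + 1), (z - x) ^ s * (1 - z) ^ (h - s) * (h.choose s : ℝ) := by
    rw [← add_pow]; ring
  rw [hx, h1x, sum_mul_sum, sum_product]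
  refine sum_congr rfl fun r _ => sum_congr rfl fun s _ => ?_
  simp only [coeff27]
  rw [neg_pow, pow_add]
  ring

/-- Splitting off `(r,s) = (0,0)`:
`x^j(1−x)^h = z^j(1−z)^h + (z−x) · Σ_{(r,s)∈T} c_{rs} (z−x)^{r+s−1}`. [cite: RhinViola2005, (2.27)] -/
theorem pow_mul_one_sub_pow_eq_add_mul_sum (z x : ℝ) (h j : ℕ) :
    x ^ j * (1 - x) ^ h = z ^ j * (1 - z) ^ h + (z - x) *
      ∑ p ∈ indexSet27 h j, coeff27 z h j p * (z - x) ^ (p.1 + p.2 - 1) := by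
  have h0 : ((0, 0) : ℕ × ℕ) ∈ range (j + 1) ×ˢ range (h + 1) := by simp
  unfold indexSet27
  rw [pow_mul_one_sub_pow_eq_sum z x h j, ← add_sum_erase _ _ h0, mul_sum]
  congr 1
  · simp [coeff27]
  · refine sum_congr rfl fun p hp => ?_
    have hp0 : p ≠ (0, 0) := (mem_erase.1 hp).1
    have hpos : 1 ≤ p.1 + p.2 := by
      rcases Nat.eq_zero_or_pos (p.1 + p.2) with h0' | h0'
      · exact absurd (Prod.ext (by simp; omega) (by simp; omega)) hp0
      · exact h0'
    obtain ⟨t, ht⟩ : ∃ t, p.1 + p.2 = t + 1 := ⟨p.1 + p.2 - 1, by omega⟩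
    rw [ht, Nat.add_sub_cancel, pow_succ]
    ring

/-- Members of `T` have `r ≤ j`, `s ≤ h` and `1 ≤ r + s ≤ h + j`. [folklore] -/
theorem mem_T {h j : ℕ} {p : ℕ × ℕ} (hp : p ∈ indexSet27 h j) :
    p.1 ≤ j ∧ p.2 ≤ h ∧ 1 ≤ p.1 + p.2 := by
  unfold indexSet27 at hp
  obtain ⟨hp0, hp'⟩ := mem_erase.1 hp
  obtain ⟨h1, h2⟩ := mem_product.1 hp'
  have h1' := mem_range.1 h1
  have h2' := mem_range.1 h2
  refine ⟨by omega, by omega, ?_⟩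
  rcases Nat.eq_zero_or_pos (p.1 + p.2) with h0' | h0'
  · exact absurd (Prod.ext (by simp; omega) (by simp; omega)) hp0
  · exact h0'

/-! ### The two integrals `∫₀¹ x^j(1−x)^h dx/(z−x)` and `∫₀¹ x^j(1−x)^h (−log x) dx/(z−x)` -/

/-- `∫₀¹ (−log x) dx/(z−x) = Li₂(1/z)` as an interval integral (RV (2.14)). [cite: RhinViola2005, (2.14)] -/
theorem intervalIntegral_neg_log_div_sub {z : ℝ} (hz : 1 < z) :
    ∫ x in (0 : ℝ)..1, -Real.log x / (z - x) = polylogSeries 2 (1 / z) := by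
  rw [integral_of_le zero_le_one, integral_Ioc_eq_integral_Ioo]
  exact integral_neg_log_div_sub hz

/-- `g(x)·(−log x/(z−x))` is interval integrable on `[0,1]` for `g` continuous and `z > 1`. [folklore] -/
theorem intervalIntegrable_mul_neg_log_div_sub {z : ℝ} (hz : 1 < z) {g : ℝ → ℝ} (hg : Continuous g) :
    IntervalIntegrable (fun x => g x * (-Real.log x / (z - x))) volume 0 1 := by
  have hc : ContinuousOn (fun x : ℝ => -g x / (z - x)) (uIcc (0 : ℝ) 1) := by
    refine (hg.neg.continuousOn).div (continuousOn_const.sub continuousOn_id) fun x hx => ?_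
    rw [Set.uIcc_of_le zero_le_one] at hx
    linarith [hx.2]
  have hi := intervalIntegrable_log'.continuousOn_mul hc (a := 0) (b := 1)
  refine hi.congr fun x _ => ?_
  ring

/-- **RV (2.25) & (2.27)**:
`∫₀¹ x^j(1−x)^h dx/(z−x) = z^j(1−z)^h Li₁(1/z) + Σ_{(r,s)∈T} c_{rs}(z^{r+s} − (z−1)^{r+s})/(r+s)`.
[cite: RhinViola2005, (2.27)] -/
theorem integral_pow_mul_one_sub_pow_div {z : ℝ} (hz : 1 < z) (h j : ℕ) :
    ∫ x in (0 : ℝ)..1, x ^ j * (1 - x) ^ h / (z - x) =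
      z ^ j * (1 - z) ^ h * polylogSeries 1 (1 / z) +
        ∑ p ∈ indexSet27 h j,
          coeff27 z h j p * ((z ^ (p.1 + p.2) - (z - 1) ^ (p.1 + p.2)) / ((p.1 + p.2 : ℕ) : ℝ)) := by
  have hpt : ∀ x ∈ uIcc (0 : ℝ) 1, x ^ j * (1 - x) ^ h / (z - x) =
      z ^ j * (1 - z) ^ h * (1 / (z - x)) +
        ∑ p ∈ indexSet27 h j, coeff27 z h j p * (z - x) ^ (p.1 + p.2 - 1) := by
    intro x hx
    rw [Set.uIcc_of_le zero_le_one] at hx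
    have hzx : z - x ≠ 0 := by linarith [hx.2]
    rw [pow_mul_one_sub_pow_eq_add_mul_sum z x h j]
    field_simp
  have hi1 : IntervalIntegrable (fun x : ℝ => z ^ j * (1 - z) ^ h * (1 / (z - x))) volume 0 1 := by
    refine (continuousOn_const.mul (continuousOn_const.div
      (by fun_prop : Continuous fun x : ℝ => z - x).continuousOn fun x hx => ?_)).intervalIntegrable
    rw [Set.uIcc_of_le zero_le_one] at hx
    exact (by linarith [hx.2] : (0 : ℝ) < z - x).ne'
  have hi2 : ∀ p ∈ indexSet27 h j,
      IntervalIntegrable (fun x : ℝ => coeff27 z h j p * (z - x) ^ (p.1 + p.2 - 1)) volume 0 1 := fun p _ =>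
    (by fun_prop : Continuous fun x : ℝ => coeff27 z h j p * (z - x) ^ (p.1 + p.2 - 1)).intervalIntegrable _ _
  have hi2' : IntervalIntegrable
      (fun x : ℝ => ∑ p ∈ indexSet27 h j, coeff27 z h j p * (z - x) ^ (p.1 + p.2 - 1)) volume 0 1 :=
    (continuous_finsetSum _ fun p _ =>
      (by fun_prop : Continuous fun x : ℝ => coeff27 z h j p * (z - x) ^ (p.1 + p.2 - 1))).intervalIntegrable _ _
  rw [integral_congr hpt, integral_add hi1 hi2', intervalIntegral.integral_const_mul, integral_one_div_sub hz,
    integral_finsetSum hi2]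
  congr 1
  refine sum_congr rfl fun p hp => ?_
  obtain ⟨_, _, hpos⟩ := mem_T hp
  obtain ⟨t, ht⟩ : ∃ t, p.1 + p.2 = t + 1 := ⟨p.1 + p.2 - 1, by omega⟩
  rw [intervalIntegral.integral_const_mul, ht, Nat.add_sub_cancel, integral_sub_pow]
  push_cast
  ring

/-- **RV (2.26) & p. 404**: `∫₀¹ x^j(1−x)^h (−log x) dx/(z−x) = z^j(1−z)^h Li₂(1/z)
 + Σ_{(r,s)∈T} c_{rs} · (1/(r+s)) Σ_{u<r+s} z^{r+s−1−u}(z^{u+1} − (z−1)^{u+1})/(u+1)`.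
[cite: RhinViola2005, Lemma 2.7 (proof), p. 404] -/
theorem integral_pow_mul_one_sub_pow_mul_neg_log_div {z : ℝ} (hz : 1 < z) (h j : ℕ) :
    ∫ x in (0 : ℝ)..1, x ^ j * (1 - x) ^ h * (-Real.log x / (z - x)) =
      z ^ j * (1 - z) ^ h * polylogSeries 2 (1 / z) +
        ∑ p ∈ indexSet27 h j, coeff27 z h j p * (1 / ((p.1 + p.2 : ℕ) : ℝ) *
          ∑ u ∈ range (p.1 + p.2), z ^ (p.1 + p.2 - 1 - u) * ((z ^ (u + 1) - (z - 1) ^ (u + 1)) / (u + 1))) := by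
  have hpt : ∀ x ∈ uIcc (0 : ℝ) 1, x ^ j * (1 - x) ^ h * (-Real.log x / (z - x)) =
      z ^ j * (1 - z) ^ h * (-Real.log x / (z - x))
        + ∑ p ∈ indexSet27 h j, coeff27 z h j p * -((z - x) ^ (p.1 + p.2 - 1) * Real.log x) := by
    intro x hx
    rw [Set.uIcc_of_le zero_le_one] at hx
    have hzx : z - x ≠ 0 := by linarith [hx.2]
    rw [pow_mul_one_sub_pow_eq_add_mul_sum z x h j, add_mul]
    congr 1
    rw [mul_comm (z - x) _, mul_assoc, show (z - x) * (-Real.log x / (z - x)) = -Real.log x by field_simp,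
      Finset.sum_mul]
    exact sum_congr rfl fun p _ => by ring
  have hi1 : IntervalIntegrable (fun x : ℝ => z ^ j * (1 - z) ^ h * (-Real.log x / (z - x))) volume 0 1 :=
    intervalIntegrable_mul_neg_log_div_sub hz continuous_const
  have hi2 : ∀ p ∈ indexSet27 h j, IntervalIntegrable
      (fun x : ℝ => coeff27 z h j p * -((z - x) ^ (p.1 + p.2 - 1) * Real.log x)) volume 0 1 := by
    intro p _
    have hi := intervalIntegrable_log'.continuousOn_mul
      (by fun_prop : Continuous fun x : ℝ => -coeff27 z h j p * (z - x) ^ (p.1 + p.2 - 1)).continuousOn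
      (a := 0) (b := 1)
    refine hi.congr fun x _ => ?_
    ring
  have hi2' : IntervalIntegrable
      (fun x : ℝ => ∑ p ∈ indexSet27 h j, coeff27 z h j p * -((z - x) ^ (p.1 + p.2 - 1) * Real.log x))
      volume 0 1 := by
    refine (IntervalIntegrable.sum _ hi2).congr fun x _ => ?_
    simp only [Finset.sum_apply]
  rw [integral_congr hpt, integral_add hi1 hi2', intervalIntegral.integral_const_mul,
    intervalIntegral_neg_log_div_sub hz, integral_finsetSum hi2]
  congr 1
  refine sum_congr rfl fun p hp => ?_
  obtain ⟨_, _, hpos⟩ := mem_T hp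
  obtain ⟨t, ht⟩ : ∃ t, p.1 + p.2 = t + 1 := ⟨p.1 + p.2 - 1, by omega⟩
  rw [intervalIntegral.integral_const_mul, intervalIntegral.integral_neg, neg_integral_sub_pow_mul_log, ht,
    Nat.add_sub_cancel]
  push_cast
  ring_nf

/-! ### The polynomials `P, Q, R` and Lemma 2.7 -/

/-- `natDegree (X^a (1−X)^b) ≤ a + b`. [folklore] -/
theorem natDegree_X_pow_mul_one_sub_X_pow_le (a b : ℕ) : ((X : ℤ[X]) ^ a * (1 - X) ^ b).natDegree ≤ a + b := by
  have h1 : ((X : ℤ[X]) ^ a).natDegree ≤ a := (natDegree_X_pow a).le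
  have h2 : ((1 - X : ℤ[X]) ^ b).natDegree ≤ b := by
    have := natDegree_pow_le_of_le b
      (show (1 - X : ℤ[X]).natDegree ≤ 1 from (natDegree_sub_le _ _).trans (by simp))
    simpa using this
  exact natDegree_mul_le.trans (add_le_add h1 h2)

/-- `natDegree (X^c − (X−1)^c) ≤ c`. [folklore] -/
theorem natDegree_X_pow_sub_X_sub_one_pow_le (c : ℕ) : ((X : ℤ[X]) ^ c - (X - 1) ^ c).natDegree ≤ c := by
  have h1 : ((X : ℤ[X]) ^ c).natDegree ≤ c := (natDegree_X_pow c).le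
  have h2 : ((X - 1 : ℤ[X]) ^ c).natDegree ≤ c := by
    have := natDegree_pow_le_of_le c
      (show (X - 1 : ℤ[X]).natDegree ≤ 1 from (natDegree_sub_le _ _).trans (by simp))
    simpa using this
  exact (natDegree_sub_le _ _).trans (max_le h1 h2)

/-- Divisibility used for `R`: for `(r,s) ∈ T`, `r + s ∣ d_{h+j}`. [cite: RhinViola2005, Lemma 2.7 (proof)] -/
theorem fst_add_snd_dvd_lcmUpto {h j : ℕ} {p : ℕ × ℕ} (hp : p ∈ indexSet27 h j) :
    ((p.1 + p.2 : ℕ) : ℤ) ∣ (Nat.lcmUpto (h + j) : ℤ) := by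
  obtain ⟨h1, h2, hpos⟩ := mem_T hp
  exact DilogPade.natCast_dvd_lcmUpto hpos (by omega)

/-- The polynomial `Q` of Lemma 2.7: `Q = −d_{h+j}² X^j (1−X)^h = (−1)^{h+1} d_{h+j}² X^j (X−1)^h`
(RV (2.28)).
[cite: RhinViola2005, (2.28)] -/
def lemma27Q (h j : ℕ) : ℤ[X] :=
  -(C ((Nat.lcmUpto (h + j) * Nat.lcmUpto (h + j) : ℕ) : ℤ) * (X ^ j * (1 - X) ^ h))

/-- The polynomial `R` of Lemma 2.7:
`R = Σ_{(r,s)∈T} C(j,r)C(h,s)(−1)^r (d_{h+j}²/(r+s)) X^{j−r}(1−X)^{h−s}(X^{r+s} − (X−1)^{r+s})`.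
[cite: RhinViola2005, (2.27)] -/
def lemma27R (h j : ℕ) : ℤ[X] :=
  ∑ p ∈ indexSet27 h j,
    C ((j.choose p.1 : ℤ) * (h.choose p.2) * (-1) ^ p.1 *
        (((Nat.lcmUpto (h + j) * Nat.lcmUpto (h + j) : ℕ) : ℤ) / (p.1 + p.2 : ℕ))) *
      (X ^ (j - p.1) * (1 - X) ^ (h - p.2) * (X ^ (p.1 + p.2) - (X - 1) ^ (p.1 + p.2)))

/-- The polynomial `P` of Lemma 2.7:
`P = Σ_{(r,s)∈T} Σ_{u<r+s} C(j,r)C(h,s)(−1)^r (d_{h+j}²/((r+s)(u+1))) X^{j−r}(1−X)^{h−s} X^{r+s−1−u}`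
`· (X^{u+1} − (X−1)^{u+1})`.
[cite: RhinViola2005, Lemma 2.7 (proof), p. 404] -/
def lemma27P (h j : ℕ) : ℤ[X] :=
  ∑ p ∈ indexSet27 h j, ∑ u ∈ range (p.1 + p.2),
    C ((j.choose p.1 : ℤ) * (h.choose p.2) * (-1) ^ p.1 *
        (((Nat.lcmUpto (h + j) * Nat.lcmUpto (h + j) : ℕ) : ℤ) / ((p.1 + p.2) * (u + 1) : ℕ))) *
      (X ^ (j - p.1) * (1 - X) ^ (h - p.2) * (X ^ (p.1 + p.2 - 1 - u) * (X ^ (u + 1) - (X - 1) ^ (u + 1))))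

/-- `deg Q ≤ h + j`. [cite: RhinViola2005, Lemma 2.7] -/
theorem natDegree_lemma27Q_le (h j : ℕ) : (lemma27Q h j).natDegree ≤ h + j := by
  rw [lemma27Q, natDegree_neg]
  refine (natDegree_C_mul_le _ _).trans ?_
  simpa [add_comm] using natDegree_X_pow_mul_one_sub_X_pow_le j h

/-- `deg R ≤ h + j`. [cite: RhinViola2005, Lemma 2.7] -/
theorem natDegree_lemma27R_le (h j : ℕ) : (lemma27R h j).natDegree ≤ h + j := by
  refine natDegree_sum_le_of_forall_le _ _ fun p hp => ?_
  obtain ⟨h1, h2, hpos⟩ := mem_T hp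
  refine (natDegree_C_mul_le _ _).trans (natDegree_mul_le.trans ?_)
  have e1 := natDegree_X_pow_mul_one_sub_X_pow_le (j - p.1) (h - p.2)
  have e2 := natDegree_X_pow_sub_X_sub_one_pow_le (p.1 + p.2)
  omega

/-- `deg P ≤ h + j`. [cite: RhinViola2005, Lemma 2.7] -/
theorem natDegree_lemma27P_le (h j : ℕ) : (lemma27P h j).natDegree ≤ h + j := by
  refine natDegree_sum_le_of_forall_le _ _ fun p hp => natDegree_sum_le_of_forall_le _ _ fun u hu => ?_
  obtain ⟨h1, h2, hpos⟩ := mem_T hp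
  have hu' : u + 1 ≤ p.1 + p.2 := mem_range.1 hu
  refine (natDegree_C_mul_le _ _).trans (natDegree_mul_le.trans ?_)
  have e1 := natDegree_X_pow_mul_one_sub_X_pow_le (j - p.1) (h - p.2)
  have e2 : ((X : ℤ[X]) ^ (p.1 + p.2 - 1 - u) * (X ^ (u + 1) - (X - 1) ^ (u + 1))).natDegree ≤ p.1 + p.2 :=
    natDegree_mul_le.trans (by
      have := natDegree_X_pow_sub_X_sub_one_pow_le (u + 1)
      have h3 : ((X : ℤ[X]) ^ (p.1 + p.2 - 1 - u)).natDegree ≤ p.1 + p.2 - 1 - u := (natDegree_X_pow _).le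
      omega)
  omega

/-- `Q(z) = −d_{h+j}² z^j (1−z)^h`. [cite: RhinViola2005, (2.28)] -/
theorem aeval_lemma27Q (h j : ℕ) (z : ℝ) :
    aeval z (lemma27Q h j) = -((Nat.lcmUpto (h + j) : ℝ) * Nat.lcmUpto (h + j) * (z ^ j * (1 - z) ^ h)) := by
  simp only [lemma27Q, map_neg, map_mul, aeval_C, map_pow, aeval_X, map_sub, map_one]
  push_cast
  ring

/-- `R(z) = d_{h+j}² Σ_{(r,s)∈T} c_{rs} (z^{r+s} − (z−1)^{r+s})/(r+s)`. [cite: RhinViola2005, (2.27)] -/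
theorem aeval_lemma27R (h j : ℕ) (z : ℝ) :
    aeval z (lemma27R h j) = (Nat.lcmUpto (h + j) : ℝ) * Nat.lcmUpto (h + j) *
      ∑ p ∈ indexSet27 h j,
        coeff27 z h j p * ((z ^ (p.1 + p.2) - (z - 1) ^ (p.1 + p.2)) / ((p.1 + p.2 : ℕ) : ℝ)) := by
  have hal : ∀ c : ℤ, algebraMap ℤ ℝ c = (c : ℝ) := fun c => by simp
  rw [lemma27R, map_sum, mul_sum]
  refine sum_congr rfl fun p hp => ?_
  obtain ⟨h1, h2, hpos⟩ := mem_T hp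
  have hdvd : ((p.1 + p.2 : ℕ) : ℤ) ∣ ((Nat.lcmUpto (h + j) * Nat.lcmUpto (h + j) : ℕ) : ℤ) := by
    rw [Nat.cast_mul]
    exact (fst_add_snd_dvd_lcmUpto hp).mul_left _
  have hne : (((p.1 + p.2 : ℕ) : ℤ) : ℝ) ≠ 0 := by positivity
  rw [map_mul, aeval_C, hal, Int.cast_mul, Int.cast_div hdvd hne]
  simp only [map_mul, map_pow, map_sub, aeval_X, map_one, coeff27]
  push_cast
  ring

/-- `P(z) = d_{h+j}² Σ_{(r,s)∈T} c_{rs} (1/(r+s)) Σ_{u<r+s} z^{r+s−1−u}(z^{u+1} − (z−1)^{u+1})/(u+1)`.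
[cite: RhinViola2005, Lemma 2.7 (proof), p. 404] -/
theorem aeval_lemma27P (h j : ℕ) (z : ℝ) :
    aeval z (lemma27P h j) = (Nat.lcmUpto (h + j) : ℝ) * Nat.lcmUpto (h + j) *
      ∑ p ∈ indexSet27 h j, coeff27 z h j p * (1 / ((p.1 + p.2 : ℕ) : ℝ) *
        ∑ u ∈ range (p.1 + p.2), z ^ (p.1 + p.2 - 1 - u) * ((z ^ (u + 1) - (z - 1) ^ (u + 1)) / (u + 1))) := by
  have hal : ∀ c : ℤ, algebraMap ℤ ℝ c = (c : ℝ) := fun c => by simp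
  rw [lemma27P, map_sum, mul_sum]
  refine sum_congr rfl fun p hp => ?_
  rw [map_sum, Finset.mul_sum, Finset.mul_sum, Finset.mul_sum]
  refine sum_congr rfl fun u hu => ?_
  obtain ⟨h1, h2, hpos⟩ := mem_T hp
  have hu' : u + 1 ≤ p.1 + p.2 := mem_range.1 hu
  have hdvd : (((p.1 + p.2) * (u + 1) : ℕ) : ℤ) ∣
      ((Nat.lcmUpto (h + j) * Nat.lcmUpto (h + j) : ℕ) : ℤ) := by
    rw [Nat.cast_mul, Nat.cast_mul]
    exact mul_dvd_mul (fst_add_snd_dvd_lcmUpto hp) (DilogPade.natCast_dvd_lcmUpto (by omega) (by omega))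
  have hne : ((((p.1 + p.2) * (u + 1) : ℕ) : ℤ) : ℝ) ≠ 0 := by positivity
  rw [map_mul, aeval_C, hal, Int.cast_mul, Int.cast_div hdvd hne]
  simp only [map_mul, map_pow, map_sub, aeval_X, map_one, coeff27]
  have ht0 : ((p.1 : ℝ) + p.2) ≠ 0 := ne_of_gt (by exact_mod_cast hpos)
  have hu0 : ((u : ℝ) + 1) ≠ 0 := by positivity
  push_cast
  field_simp

/-- **Rhin–Viola 2005, Lemma 2.7, the `Li₂` identity**: for `z > 1`,
`d_{h+j}² z^j I_z(h,j,0,0,j) = P(z) − Q(z) Li₂(1/z)`. [cite: RhinViola2005, Lemma 2.7] -/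
theorem lemma27_I {z : ℝ} (hz : 1 < z) (h j : ℕ) :
    (Nat.lcmUpto (h + j) : ℝ) * Nat.lcmUpto (h + j) * z ^ j * I z h j 0 0 j =
      aeval z (lemma27P h j) - aeval z (lemma27Q h j) * polylogSeries 2 (1 / z) := by
  have hz0 : z ≠ 0 := by positivity
  rw [I_h_j hz, integral_pow_mul_one_sub_pow_mul_neg_log_div hz, aeval_lemma27P, aeval_lemma27Q, zpow_neg,
    zpow_natCast]
  field_simp
  ring

/-- **Rhin–Viola 2005, Lemma 2.7, the `Li₁` identity**: for `z > 1`,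
`d_{h+j}² z^j I_z^{(1)}(h,j,0,0,j) = R(z) − Q(z) Li₁(1/z)`. [cite: RhinViola2005, Lemma 2.7, (2.27)–(2.28)] -/
theorem lemma27_I1 {z : ℝ} (hz : 1 < z) (h j : ℕ) :
    (Nat.lcmUpto (h + j) : ℝ) * Nat.lcmUpto (h + j) * z ^ j * I1 z h j 0 0 j =
      aeval z (lemma27R h j) - aeval z (lemma27Q h j) * polylogSeries 1 (1 / z) := by
  have hz0 : z ≠ 0 := by positivity
  rw [I1_h_j, integral_pow_mul_one_sub_pow_div hz, aeval_lemma27R, aeval_lemma27Q, zpow_neg, zpow_natCast]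
  field_simp
  ring

/-- **Rhin–Viola 2005, Lemma 2.7, the coefficient `Q`**: for `z ≠ 0`,
`d_{h+j}² z^j I_z^{(2)}(h,j,0,0,j) = Q(z)`. [cite: RhinViola2005, Lemma 2.7, (2.28)] -/
theorem lemma27_I2 {z : ℝ} (hz : z ≠ 0) (h j : ℕ) :
    (Nat.lcmUpto (h + j) : ℝ) * Nat.lcmUpto (h + j) * z ^ j * I2 z h j 0 0 j = aeval z (lemma27Q h j) := by
  rw [I2_h_j hz, aeval_lemma27Q]
  ring

/-- **Rhin–Viola 2005, Lemma 2.7** (Theorem 2.1 for `(h, j, 0, 0, j)`; `H = K = δ = h+j`, `α = j`, `β = 0`):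
there are `P, Q, R ∈ ℤ[X]` of degree `≤ h + j` with, for every real `z > 1`,
`d_{h+j}² z^j I_z(h,j,0,0,j) = P(z) − Q(z) Li₂(1/z)`, `d_{h+j}² z^j I_z^{(1)}(h,j,0,0,j) = R(z) − Q(z) Li₁(1/z)`,
`d_{h+j}² z^j I_z^{(2)}(h,j,0,0,j) = Q(z)`. [cite: RhinViola2005, Lemma 2.7] -/
theorem lemma27 (h j : ℕ) :
    ∃ P Q R : ℤ[X], P.natDegree ≤ h + j ∧ Q.natDegree ≤ h + j ∧ R.natDegree ≤ h + j ∧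
      ∀ z : ℝ, 1 < z →
        (Nat.lcmUpto (h + j) : ℝ) * Nat.lcmUpto (h + j) * z ^ j * I z h j 0 0 j =
            aeval z P - aeval z Q * polylogSeries 2 (1 / z) ∧
        (Nat.lcmUpto (h + j) : ℝ) * Nat.lcmUpto (h + j) * z ^ j * I1 z h j 0 0 j =
            aeval z R - aeval z Q * polylogSeries 1 (1 / z) ∧
        (Nat.lcmUpto (h + j) : ℝ) * Nat.lcmUpto (h + j) * z ^ j * I2 z h j 0 0 j = aeval z Q :=
  ⟨lemma27P h j, lemma27Q h j, lemma27R h j, natDegree_lemma27P_le h j, natDegree_lemma27Q_le h j,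
    natDegree_lemma27R_le h j,
    fun _ hz => ⟨lemma27_I hz h j, lemma27_I1 hz h j, lemma27_I2 (by positivity) h j⟩⟩

end RhinViola

end Literature.NumberTheory.DiophantineApproximation

end
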